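import Mathlib
import HarnessLib

/-!
# Cross-matrix norm bounds from star codegrees — auxiliary file 1/2 (generic linear algebra)

Helper file for the registered stub `stub_crossNormOfCodegrees` of crux stmt-PneNP-9817
(`Summit.PneNP.PneNP.Theses.RamseyUncertifiable.PaleySosRung`, line `weil-patch-transfer`):
deterministic operator-norm bounds, in bilinear form, for the rectangular Meka–Potechin–Wigderson
cross matrices `R_{a,b}` of a graph, derived from concentration of its star codegrees.

This file contains the graph-free ingredients, all over finite sums of reals:

* a **Newton bound** for elementary symmetric polynomials: if `|p_j| ≤ X ^ j` for the power
  sums `p_j` (`1 ≤ j ≤ k`) then `|e_k| ≤ X ^ k` (`abs_esymm_le_pow`, via Mathlib's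
  `MvPolynomial.mul_esymm_eq_sum`), and its corollary for bounded families
  (`abs_sum_powersetCard_prod_le`);
* Cauchy–Schwarz with absolute values, the **Schur test** for bilinear forms
  (`abs_sum_sum_mul_mul_le`) and the expansion of `‖Tᵀ u‖²` (`sum_sq_sum_mul_eq`);
* four counting lemmas on `k`-subsets of a finite type (`card_filter_mem_le`, …);
* the exchange-of-summation identity behind `N_k v (W') = Σ_{W ⊇ W'} v W` and the bound
  `‖N_k v‖² ≤ N^(b-k) 2^b ‖v‖²` (`norm_sq_superset_sum_le`).

All statements are elementary; no definitions are introduced. [folklore]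
-/

set_option linter.dupNamespace false -- `Summit.PneNP.PneNP.…`: summit = sub-problem (D-0017)

namespace Summit.PneNP.PneNP.Theorems.PaleySosRungWeilPatch

namespace CrossNorm

open Finset

section Newton

variable {ι : Type*} [Fintype ι]

/-- **Newton's identity, evaluated** (Mathlib `MvPolynomial.mul_esymm_eq_sum` under `aeval f`),
over `ℝ`: `k e_k = (-1)^{k+1} ∑_{i+j=k, i<k} (-1)^i e_i p_j` for the elementary symmetric
functions `e_i` and the power sums `p_j = ∑ f^j` of a finite family of reals. [folklore] -/
theorem natCast_mul_esymm_eq_sum_powerSum (f : ι → ℝ) (k : ℕ) :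
    (k : ℝ) * (univ.val.map f).esymm k = (-1) ^ (k + 1) *
      ∑ a ∈ antidiagonal k with a.1 < k,
        (-1) ^ a.1 * (univ.val.map f).esymm a.1 * ∑ i, f i ^ a.2 := by
  have h := congrArg (MvPolynomial.aeval f) (MvPolynomial.mul_esymm_eq_sum ι ℝ k)
  simpa only [map_mul, map_natCast, map_pow, map_neg, map_one, map_sum,
    MvPolynomial.aeval_esymm_eq_multiset_esymm, MvPolynomial.psum, MvPolynomial.aeval_X] using h

/-- `e_0 = 1`. [folklore] -/
theorem esymm_map_zero (f : ι → ℝ) : (univ.val.map f).esymm 0 = 1 := by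
  simp [Multiset.esymm, Multiset.powersetCard_zero_left]

/-- **Newton bound.** If the power sums satisfy `|p_j| ≤ X ^ j` for `1 ≤ j ≤ k` (`X ≥ 0`) then
`|e_k| ≤ X ^ k`: by strong induction, `k |e_k| ≤ ∑_{i<k} |e_i| |p_{k-i}| ≤ k X^k`. [folklore] -/
theorem abs_esymm_le_pow (f : ι → ℝ) {X : ℝ} (hX : 0 ≤ X) :
    ∀ k : ℕ, (∀ j, 1 ≤ j → j ≤ k → |∑ i, f i ^ j| ≤ X ^ j) →
      |(univ.val.map f).esymm k| ≤ X ^ k := by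
  intro k
  induction k using Nat.strong_induction_on with
  | _ k ih =>
    intro hp
    rcases Nat.eq_zero_or_pos k with hk0 | hk
    · subst hk0
      rw [esymm_map_zero, abs_one, pow_zero]
    have hfilt : (antidiagonal k).filter (fun a : ℕ × ℕ => a.1 < k) =
        (antidiagonal k).erase (k, 0) := by
      ext ⟨i, j⟩
      simp only [mem_filter, mem_erase, Finset.HasAntidiagonal.mem_antidiagonal, ne_eq,
        Prod.mk.injEq]
      constructor
      · rintro ⟨h, hi⟩
        exact ⟨fun h' => absurd h'.1 hi.ne, h⟩
      · rintro ⟨hne, h⟩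
        refine ⟨h, lt_of_le_of_ne (by omega) fun hi => hne ⟨hi, by omega⟩⟩
    have hmem : (k, 0) ∈ antidiagonal k := by simp
    have hterm : ∀ a ∈ (antidiagonal k).erase (k, 0),
        |(-1 : ℝ) ^ a.1 * (univ.val.map f).esymm a.1 * ∑ i, f i ^ a.2| ≤ X ^ k := by
      intro a ha
      rw [mem_erase, Finset.HasAntidiagonal.mem_antidiagonal] at ha
      obtain ⟨hne, hsum⟩ := ha
      have ha1 : a.1 < k := by
        rcases Nat.lt_or_ge a.1 k with h | h
        · exact h
        · exfalso
          have h1 : a.1 = k := by omega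
          have h2 : a.2 = 0 := by omega
          exact hne (Prod.ext h1 h2)
      have ha2 : 1 ≤ a.2 := by omega
      have ha2' : a.2 ≤ k := by omega
      rw [abs_mul, abs_mul, abs_pow, abs_neg, abs_one, one_pow, one_mul]
      have he : |(univ.val.map f).esymm a.1| ≤ X ^ a.1 :=
        ih a.1 ha1 fun j hj1 hj2 => hp j hj1 (hj2.trans ha1.le)
      calc |(univ.val.map f).esymm a.1| * |∑ i, f i ^ a.2| ≤ X ^ a.1 * X ^ a.2 :=
            mul_le_mul he (hp a.2 ha2 ha2') (abs_nonneg _) (by positivity)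
        _ = X ^ k := by rw [← pow_add, hsum]
    have hk0 : (0 : ℝ) < k := by exact_mod_cast hk
    have hmain : (k : ℝ) * |(univ.val.map f).esymm k| ≤ k * X ^ k := by
      calc (k : ℝ) * |(univ.val.map f).esymm k| = |(k : ℝ) * (univ.val.map f).esymm k| := by
            rw [abs_mul, Nat.abs_cast]
        _ = |∑ a ∈ (antidiagonal k).erase (k, 0),
              (-1 : ℝ) ^ a.1 * (univ.val.map f).esymm a.1 * ∑ i, f i ^ a.2| := by
            rw [natCast_mul_esymm_eq_sum_powerSum, hfilt, abs_mul, abs_pow, abs_neg, abs_one,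
              one_pow, one_mul]
        _ ≤ ∑ a ∈ (antidiagonal k).erase (k, 0),
              |(-1 : ℝ) ^ a.1 * (univ.val.map f).esymm a.1 * ∑ i, f i ^ a.2| :=
            abs_sum_le_sum_abs _ _
        _ ≤ ∑ a ∈ (antidiagonal k).erase (k, 0), X ^ k := sum_le_sum hterm
        _ = k * X ^ k := by
            rw [sum_const, card_erase_of_mem hmem, Finset.Nat.card_antidiagonal, nsmul_eq_mul]
            push_cast
            ring
    exact le_of_mul_le_mul_left hmain hk0

/-- **Newton bound for bounded families.** If `|f i| ≤ L` (`L ≥ 0`) for all `i`, and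
`X ≥ |∑ f i|`, `X ≥ L √N` (`N` the number of indices), then the `k`-th elementary symmetric
function of the `f i` has modulus at most `X ^ k`: indeed `|p_1| ≤ X` and, for `j ≥ 2`,
`|p_j| ≤ N L^j ≤ (L √N)^j ≤ X^j`. [folklore] -/
theorem abs_sum_powersetCard_prod_le (f : ι → ℝ) {L X : ℝ} (hL0 : 0 ≤ L)
    (hL : ∀ i, |f i| ≤ L) (h1 : |∑ i, f i| ≤ X)
    (h2 : L * Real.sqrt (Fintype.card ι) ≤ X) (k : ℕ) :
    |∑ t ∈ powersetCard k univ, ∏ i ∈ t, f i| ≤ X ^ k := by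
  have hX : 0 ≤ X := (abs_nonneg _).trans h1
  have key := abs_esymm_le_pow f hX k ?_
  · rw [Finset.esymm_map_val] at key
    exact key
  intro j hj1 _
  rcases Nat.eq_or_lt_of_le hj1 with h | h
  · subst h
    simpa using h1
  · have hj2 : 2 ≤ j := h
    calc |∑ i, f i ^ j| ≤ ∑ i, |f i ^ j| := abs_sum_le_sum_abs _ _
      _ ≤ ∑ _i : ι, L ^ j := sum_le_sum fun i _ => by
          rw [abs_pow]; exact pow_le_pow_left₀ (abs_nonneg _) (hL i) j
      _ = (Fintype.card ι : ℝ) * L ^ j := by rw [sum_const, card_univ, nsmul_eq_mul]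
      _ ≤ (Real.sqrt (Fintype.card ι)) ^ j * L ^ j := by
          refine mul_le_mul_of_nonneg_right ?_ (by positivity)
          rcases Nat.eq_zero_or_pos (Fintype.card ι) with h0 | hpos
          · rw [h0]; simp
          · have h1le : (1 : ℝ) ≤ Real.sqrt (Fintype.card ι) := by
              rw [Real.one_le_sqrt]; exact_mod_cast hpos
            calc (Fintype.card ι : ℝ) = Real.sqrt (Fintype.card ι) ^ 2 := by
                  rw [Real.sq_sqrt]; positivity
              _ ≤ Real.sqrt (Fintype.card ι) ^ j := pow_le_pow_right₀ h1le hj2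
      _ = (L * Real.sqrt (Fintype.card ι)) ^ j := by rw [mul_pow, mul_comm]
      _ ≤ X ^ j := pow_le_pow_left₀ (by positivity) h2 j

end Newton

section Bilinear

/-- **Cauchy–Schwarz** for finite sums of reals, with an absolute value on the left. [folklore] -/
theorem abs_sum_mul_le_sqrt_mul_sqrt {β : Type*} (s : Finset β) (f g : β → ℝ) :
    |∑ i ∈ s, f i * g i| ≤ Real.sqrt (∑ i ∈ s, f i ^ 2) * Real.sqrt (∑ i ∈ s, g i ^ 2) := by
  refine abs_le.2 ⟨?_, Real.sum_mul_le_sqrt_mul_sqrt s f g⟩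
  have h := Real.sum_mul_le_sqrt_mul_sqrt s (fun i => -f i) g
  simp only [neg_mul, sum_neg_distrib, even_two, Even.neg_pow] at h
  linarith

/-- **Schur test** (bilinear form): if every row sum and every column sum of `|M|` over `s` is at
most `ρ`, then `|∑_{V,V'} u_V u_{V'} M(V,V')| ≤ ρ ∑_V u_V²`, from `2|u_V u_{V'}| ≤ u_V² + u_{V'}²`.
[folklore] -/
theorem abs_sum_sum_mul_mul_le {β : Type*} (s : Finset β) (M : β → β → ℝ) (u : β → ℝ) {ρ : ℝ}
    (hrow : ∀ V ∈ s, ∑ V' ∈ s, |M V V'| ≤ ρ) (hcol : ∀ V' ∈ s, ∑ V ∈ s, |M V V'| ≤ ρ) :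
    |∑ V ∈ s, ∑ V' ∈ s, u V * u V' * M V V'| ≤ ρ * ∑ V ∈ s, u V ^ 2 := by
  have h1 : |∑ V ∈ s, ∑ V' ∈ s, u V * u V' * M V V'|
      ≤ ∑ V ∈ s, ∑ V' ∈ s, (u V ^ 2 * |M V V'| + u V' ^ 2 * |M V V'|) / 2 := by
    refine (abs_sum_le_sum_abs _ _).trans (sum_le_sum fun V _ => ?_)
    refine (abs_sum_le_sum_abs _ _).trans (sum_le_sum fun V' _ => ?_)
    rw [abs_mul, abs_mul]
    have h2 : 2 * (|u V| * |u V'|) ≤ u V ^ 2 + u V' ^ 2 := by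
      have := two_mul_le_add_sq (|u V|) (|u V'|)
      rw [sq_abs, sq_abs] at this
      linarith
    have hM : 0 ≤ |M V V'| := abs_nonneg _
    nlinarith
  refine h1.trans ?_
  have hsplit : ∑ V ∈ s, ∑ V' ∈ s, (u V ^ 2 * |M V V'| + u V' ^ 2 * |M V V'|) / 2
      = (∑ V ∈ s, u V ^ 2 * ∑ V' ∈ s, |M V V'|) / 2
        + (∑ V' ∈ s, u V' ^ 2 * ∑ V ∈ s, |M V V'|) / 2 := by
    simp only [sum_div, sum_add_distrib, mul_sum, add_div]
    congr 1
    exact sum_comm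
  rw [hsplit]
  have hA : ∑ V ∈ s, u V ^ 2 * ∑ V' ∈ s, |M V V'| ≤ ρ * ∑ V ∈ s, u V ^ 2 := by
    rw [mul_sum]
    exact sum_le_sum fun V hV => by
      rw [mul_comm]
      exact mul_le_mul_of_nonneg_right (hrow V hV) (sq_nonneg _)
  have hB : ∑ V' ∈ s, u V' ^ 2 * ∑ V ∈ s, |M V V'| ≤ ρ * ∑ V ∈ s, u V ^ 2 := by
    rw [mul_sum]
    exact sum_le_sum fun V' hV' => by
      rw [mul_comm]
      exact mul_le_mul_of_nonneg_right (hcol V' hV') (sq_nonneg _)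
  linarith

/-- Expansion of `‖Tᵀ u‖²`: `∑_w (∑_v u_v T(v,w))² = ∑_{v,v'} u_v u_{v'} ∑_w T(v,w) T(v',w)`.
[folklore] -/
theorem sum_sq_sum_mul_eq {β γ : Type*} (s : Finset β) (t : Finset γ) (u : β → ℝ)
    (T : β → γ → ℝ) :
    ∑ w ∈ t, (∑ v ∈ s, u v * T v w) ^ 2
      = ∑ v ∈ s, ∑ v' ∈ s, u v * u v' * ∑ w ∈ t, T v w * T v' w := by
  have h : ∀ w ∈ t, (∑ v ∈ s, u v * T v w) ^ 2
      = ∑ v ∈ s, ∑ v' ∈ s, u v * u v' * (T v w * T v' w) := by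
    intro w _
    rw [sq, sum_mul_sum]
    refine sum_congr rfl fun v _ => sum_congr rfl fun v' _ => by ring
  rw [sum_congr rfl h, sum_comm]
  refine sum_congr rfl fun v _ => ?_
  rw [sum_comm]
  refine sum_congr rfl fun v' _ => ?_
  rw [mul_sum]

end Bilinear

section Counting

variable {α : Type*} [Fintype α] [DecidableEq α]

/-- The number of `a`-subsets of an `N`-element type containing a given point is at most
`C(N, a-1) ≤ N^(a-1)` (inject by erasing the point). [folklore] -/
theorem card_filter_mem_le (a : ℕ) (x : α) :
    (((powersetCard a (univ : Finset α)).filter fun V => x ∈ V).card : ℝ)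
      ≤ (Fintype.card α : ℝ) ^ (a - 1) := by
  have h : ((powersetCard a (univ : Finset α)).filter fun V => x ∈ V).card
      ≤ (powersetCard (a - 1) (univ : Finset α)).card := by
    refine card_le_card_of_injOn (fun V => V.erase x) (fun V hV => ?_) (fun V hV V' hV' h => ?_)
    · simp only [coe_filter, mem_powersetCard_univ, Set.mem_setOf_eq] at hV
      simp only [mem_coe, mem_powersetCard_univ, card_erase_of_mem hV.2, hV.1]
    · simp only [coe_filter, mem_powersetCard_univ, Set.mem_setOf_eq] at hV hV'
      rw [← insert_erase hV.2, ← insert_erase hV'.2]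
      exact congrArg (insert x) h
  calc (((powersetCard a (univ : Finset α)).filter fun V => x ∈ V).card : ℝ)
      ≤ (powersetCard (a - 1) (univ : Finset α)).card := by exact_mod_cast h
    _ = (Fintype.card α).choose (a - 1) := by rw [card_powersetCard, card_univ]
    _ ≤ (Fintype.card α : ℝ) ^ (a - 1) := by exact_mod_cast Nat.choose_le_pow _ _

/-- The number of `b`-subsets containing a given finite set `W'` is at most `N^(b - |W'|)`
(inject by removing `W'`). [folklore] -/
theorem card_filter_superset_le (b : ℕ) (W' : Finset α) :
    (((powersetCard b (univ : Finset α)).filter fun W => W' ⊆ W).card : ℝ)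
      ≤ (Fintype.card α : ℝ) ^ (b - W'.card) := by
  have h : ((powersetCard b (univ : Finset α)).filter fun W => W' ⊆ W).card
      ≤ (powersetCard (b - W'.card) (univ : Finset α)).card := by
    refine card_le_card_of_injOn (fun W => W \ W') (fun W hW => ?_) (fun W hW W₂ hW₂ h => ?_)
    · simp only [coe_filter, mem_powersetCard_univ, Set.mem_setOf_eq] at hW
      simp only [mem_coe, mem_powersetCard_univ, card_sdiff_of_subset hW.2, hW.1]
    · simp only [coe_filter, mem_powersetCard_univ, Set.mem_setOf_eq] at hW hW₂
      have e1 := sdiff_union_of_subset hW.2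
      have e2 := sdiff_union_of_subset hW₂.2
      rw [← e1, ← e2]
      exact congrArg (· ∪ W') h
  calc (((powersetCard b (univ : Finset α)).filter fun W => W' ⊆ W).card : ℝ)
      ≤ (powersetCard (b - W'.card) (univ : Finset α)).card := by exact_mod_cast h
    _ = (Fintype.card α).choose (b - W'.card) := by rw [card_powersetCard, card_univ]
    _ ≤ (Fintype.card α : ℝ) ^ (b - W'.card) := by exact_mod_cast Nat.choose_le_pow _ _

/-- The number of `k`-subsets of a finite set `W`, counted among all `k`-sets, is at most
`2^|W|`. [folklore] -/
theorem card_filter_subset_le (k : ℕ) (W : Finset α) :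
    (((powersetCard k (univ : Finset α)).filter fun W' => W' ⊆ W).card : ℝ)
      ≤ (2 : ℝ) ^ W.card := by
  have h : ((powersetCard k (univ : Finset α)).filter fun W' => W' ⊆ W) ⊆ W.powerset := by
    intro W' hW'
    simp only [mem_filter, mem_powersetCard_univ] at hW'
    exact mem_powerset.2 hW'.2
  calc (((powersetCard k (univ : Finset α)).filter fun W' => W' ⊆ W).card : ℝ)
      ≤ (W.powerset.card : ℝ) := by exact_mod_cast card_le_card h
    _ = (2 : ℝ) ^ W.card := by rw [card_powerset]; push_cast; ring

/-- The number of `a`-sets meeting a given finite set `V` is at most `|V| · N^(a-1)`.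
[folklore] -/
theorem card_filter_not_disjoint_le (a : ℕ) (V : Finset α) :
    (((powersetCard a (univ : Finset α)).filter fun V' => ¬ Disjoint V V').card : ℝ)
      ≤ (V.card : ℝ) * (Fintype.card α : ℝ) ^ (a - 1) := by
  have hsub : ((powersetCard a (univ : Finset α)).filter fun V' => ¬ Disjoint V V')
      ⊆ V.biUnion fun x => (powersetCard a (univ : Finset α)).filter fun V' => x ∈ V' := by
    intro V' hV'
    simp only [mem_filter, mem_powersetCard_univ, not_disjoint_iff] at hV'
    obtain ⟨hc, x, hxV, hxV'⟩ := hV'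
    simp only [mem_biUnion, mem_filter, mem_powersetCard_univ]
    exact ⟨x, hxV, hc, hxV'⟩
  calc (((powersetCard a (univ : Finset α)).filter fun V' => ¬ Disjoint V V').card : ℝ)
      ≤ ((V.biUnion fun x =>
          (powersetCard a (univ : Finset α)).filter fun V' => x ∈ V').card : ℝ) := by
        exact_mod_cast card_le_card hsub
    _ ≤ ∑ x ∈ V, (((powersetCard a (univ : Finset α)).filter fun V' => x ∈ V').card : ℝ) := by
        exact_mod_cast card_biUnion_le
    _ ≤ ∑ _x ∈ V, (Fintype.card α : ℝ) ^ (a - 1) := sum_le_sum fun x _ => card_filter_mem_le a x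
    _ = (V.card : ℝ) * (Fintype.card α : ℝ) ^ (a - 1) := by rw [sum_const, nsmul_eq_mul]

/-- **Exchange of summation** behind the operator `N_k`: summing `v W · Σ_{W' ⊆ W, |W'| = k} g W'`
over a family of sets `W` is summing `g W' · Σ_{W ⊇ W'} v W` over all `k`-sets `W'`. [folklore] -/
theorem sum_mul_sum_powersetCard_eq (sB : Finset (Finset α)) (k : ℕ) (g v : Finset α → ℝ) :
    ∑ W ∈ sB, v W * ∑ W' ∈ powersetCard k W, g W'
      = ∑ W' ∈ powersetCard k univ, g W' * ∑ W ∈ sB.filter (fun W => W' ⊆ W), v W := by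
  have hpc : ∀ W : Finset α,
      powersetCard k W = (powersetCard k univ).filter (fun W' => W' ⊆ W) := by
    intro W
    ext W'
    simp only [mem_powersetCard, mem_filter, subset_univ, true_and]
    exact and_comm
  have hL : ∀ W ∈ sB, v W * ∑ W' ∈ powersetCard k W, g W'
      = ∑ W' ∈ powersetCard k univ, (if W' ⊆ W then v W * g W' else 0) := by
    intro W _
    rw [hpc W, sum_filter, mul_sum]
    refine sum_congr rfl fun W' _ => ?_
    split_ifs <;> simp
  have hR : ∀ W' ∈ powersetCard k (univ : Finset α),
      g W' * ∑ W ∈ sB.filter (fun W => W' ⊆ W), v W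
        = ∑ W ∈ sB, (if W' ⊆ W then v W * g W' else 0) := by
    intro W' _
    rw [sum_filter, mul_sum]
    refine sum_congr rfl fun W _ => ?_
    split_ifs <;> ring
  rw [sum_congr rfl hL, sum_congr rfl hR, sum_comm]

/-- **`‖N_k v‖² ≤ N^(b-k) 2^b ‖v‖²`**: for `(N_k v)(W') = Σ_{W ⊇ W', |W| = b} v W` on `k`-sets `W'`,
by Cauchy–Schwarz in `W` (each `W'` has at most `N^(b-k)` supersets of size `b`) and double
counting (each `W` has at most `2^b` subsets). [folklore] -/
theorem norm_sq_superset_sum_le (b k : ℕ) (v : Finset α → ℝ) :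
    ∑ W' ∈ powersetCard k (univ : Finset α),
        (∑ W ∈ (powersetCard b (univ : Finset α)).filter (fun W => W' ⊆ W), v W) ^ 2
      ≤ (Fintype.card α : ℝ) ^ (b - k) * (2 : ℝ) ^ b
          * ∑ W ∈ powersetCard b (univ : Finset α), v W ^ 2 := by
  set N : ℝ := (Fintype.card α : ℝ) with hN
  have hN0 : 0 ≤ N := by positivity
  calc ∑ W' ∈ powersetCard k (univ : Finset α),
        (∑ W ∈ (powersetCard b (univ : Finset α)).filter (fun W => W' ⊆ W), v W) ^ 2
      ≤ ∑ W' ∈ powersetCard k (univ : Finset α),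
          N ^ (b - k) * ∑ W ∈ (powersetCard b (univ : Finset α)).filter (fun W => W' ⊆ W),
            v W ^ 2 := by
        refine sum_le_sum fun W' hW' => ?_
        rw [mem_powersetCard_univ] at hW'
        refine (sq_sum_le_card_mul_sum_sq).trans ?_
        refine mul_le_mul_of_nonneg_right ?_ (sum_nonneg fun _ _ => sq_nonneg _)
        have := card_filter_superset_le b W'
        rw [hW'] at this
        exact this
    _ = N ^ (b - k) * ∑ W ∈ powersetCard b (univ : Finset α),
          v W ^ 2 * (((powersetCard k (univ : Finset α)).filter fun W' => W' ⊆ W).card : ℝ) := by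
        rw [← mul_sum]
        congr 1
        simp_rw [sum_filter]
        rw [sum_comm]
        refine sum_congr rfl fun W _ => ?_
        rw [← sum_filter, sum_const, nsmul_eq_mul, mul_comm]
    _ ≤ N ^ (b - k) * ∑ W ∈ powersetCard b (univ : Finset α), v W ^ 2 * (2 : ℝ) ^ b := by
        refine mul_le_mul_of_nonneg_left (sum_le_sum fun W hW => ?_) (by positivity)
        rw [mem_powersetCard_univ] at hW
        refine mul_le_mul_of_nonneg_left ?_ (sq_nonneg _)
        have := card_filter_subset_le k W
        rw [hW] at this
        exact this
    _ = N ^ (b - k) * (2 : ℝ) ^ b * ∑ W ∈ powersetCard b (univ : Finset α), v W ^ 2 := by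
        rw [mul_assoc, ← sum_mul, mul_comm (∑ W ∈ _, _)]

end Counting

end CrossNorm

/-- **Registered helper stub `cn_newtonBound`** (sub-goal of `stub_crossNormOfCodegrees` on
stmt-PneNP-9817): the Newton bound for a bounded family, `|e_k(f)| ≤ X^k` whenever `|f i| ≤ L`,
`|Σ f| ≤ X` and `L √N ≤ X` — a restatement of `CrossNorm.abs_sum_powersetCard_prod_le`.
[folklore] -/
theorem cn_newtonBound : ∀ {ι : Type*} [Fintype ι] (f : ι → ℝ) (L X : ℝ), 0 ≤ L →
    (∀ i, |f i| ≤ L) → |∑ i, f i| ≤ X → L * Real.sqrt (Fintype.card ι) ≤ X → ∀ k : ℕ,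
    |∑ t ∈ Finset.powersetCard k Finset.univ, ∏ i ∈ t, f i| ≤ X ^ k :=
  fun f _ _ hL0 hL h1 h2 k => CrossNorm.abs_sum_powersetCard_prod_le f hL0 hL h1 h2 k

end Summit.PneNP.PneNP.Theorems.PaleySosRungWeilPatch
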